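import Mathlib
import Summits.Ventures.PercRepro2.SwOutAll
import Summits.Ventures.PercRepro2.SwOutSeriesDefs

/-!
# The series reduction inside an outside class, part 2: the contraction half — clusters and the
class (blind cell PercRepro2, night-4 g10, 2026-08-25; proofs/NIGHT4-G10.md §2 (a))

With both edges of the series vertex open, the contracted graph `G/u` sees the same clusters on
`V ∖ {u}` and `u` rides with `p` (`mem_cluster_contract_iff`, `mem_cluster_contract_u_iff`); for a
configuration with `ζ e₁ = ζ e₂` (any colour) this holds for any recolouring of the loop
(`mem_cluster_contract_iff_of_same`), the edges touching `U ∖ {u}` are those touching `U` other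
than `e₁` (`mem_touches_contract_iff`), and the outside classes correspond under the canonical map
`ζ ↦ ζ[e₁ ↦ false]` (`mem_swOutSide_contract_iff_of_same`).
-/

namespace Summit.Ventures.PercRepro2

namespace LocRows

open Hull

variable {V : Type*} {E : Type*} [Fintype E] [DecidableEq E]

open scoped Classical

variable {ends : E → Sym2 V} {u p q : V} {e₁ e₂ : E}

section Contract

variable (hs : IsSeriesAt ends u p q e₁ e₂) {ω : Config E} (h₁ : ω e₁ = true) (h₂ : ω e₂ = true)
include hs

omit [Fintype E] in
/-- `u` is isolated in the contracted graph. -/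
lemma u_notMem_cluster_contract {x : V} (hx : x ≠ u) :
    u ∉ cluster (contractSeries ends u p q e₁ e₂) ω x := by
  intro hu
  have key : u ∈ ({v | v ≠ u} : Set V) := by
    refine mem_of_conn_of_closed (ends := contractSeries ends u p q e₁ e₂) (ω := ω) ?_ hx hu
    intro a ha b hab
    obtain ⟨hne, e, _, hends⟩ := openGraph_adj.1 hab
    by_cases he₁ : e = e₁
    · subst he₁
      rw [contractSeries_apply_e₁, Sym2.eq_iff] at hends
      exact absurd (by rcases hends with ⟨h, h'⟩ | ⟨h, h'⟩ <;> first | exact h.symm.trans h' | exact h'.symm.trans h) hne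
    by_cases he₂ : e = e₂
    · subst he₂
      rw [contractSeries_apply_e₂ hs.ne, Sym2.eq_iff] at hends
      rcases hends with ⟨_, hqb⟩ | ⟨hpb, _⟩
      · exact hqb ▸ hs.uq.symm
      · exact hpb ▸ hs.up.symm
    · rw [contractSeries_apply_of_ne he₁ he₂] at hends
      exact ne_u_of_mem_ends hs he₁ he₂ (by rw [hends]; exact Sym2.mem_mk_right a b)
  exact key rfl

include h₁ h₂

omit [Fintype E] in
/-- A cluster of the contracted graph lies in the cluster of the original graph. -/
lemma cluster_contract_subset (x : V) :
    cluster (contractSeries ends u p q e₁ e₂) ω x ⊆ cluster ends ω x := by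
  intro v hv
  refine mem_of_conn_of_closed (ends := contractSeries ends u p q e₁ e₂) (ω := ω)
    (S := cluster ends ω x) ?_ (mem_cluster_self _ _ _) hv
  intro a ha b hab
  obtain ⟨hne, e, he, hends⟩ := openGraph_adj.1 hab
  by_cases he₁ : e = e₁
  · subst he₁
    rw [contractSeries_apply_e₁, Sym2.eq_iff] at hends
    exact absurd (by rcases hends with ⟨h, h'⟩ | ⟨h, h'⟩ <;> first | exact h.symm.trans h' | exact h'.symm.trans h) hne
  by_cases he₂ : e = e₂
  · subst he₂
    rw [contractSeries_apply_e₂ hs.ne, Sym2.eq_iff] at hends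
    rcases hends with ⟨rfl, rfl⟩ | ⟨rfl, rfl⟩
    · -- `a = p`, `b = q`: through `u`
      have hu : u ∈ cluster ends ω x :=
        mem_cluster_of_edge ha h₁ (ends_swap hs.ends₁)
      exact mem_cluster_of_edge hu h₂ hs.ends₂
    · have hu : u ∈ cluster ends ω x :=
        mem_cluster_of_edge ha h₂ (ends_swap hs.ends₂)
      exact mem_cluster_of_edge hu h₁ hs.ends₁
  · rw [contractSeries_apply_of_ne he₁ he₂] at hends
    exact mem_cluster_of_edge ha he hends

omit [Fintype E] in
/-- The cluster of the original graph lies in the contracted cluster, plus `u` when `p` is there. -/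
lemma cluster_subset_contract {x : V} (hx : x ≠ u) :
    cluster ends ω x ⊆
      cluster (contractSeries ends u p q e₁ e₂) ω x ∪
        {v | v = u ∧ p ∈ cluster (contractSeries ends u p q e₁ e₂) ω x} := by
  intro v hv
  refine mem_of_conn_of_closed (ends := ends) (ω := ω) ?_ (Or.inl (mem_cluster_self _ _ _)) hv
  intro a ha b hab
  obtain ⟨hne, e, he, hends⟩ := openGraph_adj.1 hab
  -- membership of a vertex `≠ u` of the closure set means membership in the contracted cluster
  have hS : ∀ w, w ≠ u → w ∈ cluster (contractSeries ends u p q e₁ e₂) ω x ∪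
      {v | v = u ∧ p ∈ cluster (contractSeries ends u p q e₁ e₂) ω x} →
      w ∈ cluster (contractSeries ends u p q e₁ e₂) ω x := by
    intro w hw hwS
    rcases hwS with h | ⟨rfl, _⟩
    · exact h
    · exact absurd rfl hw
  -- `p` and `q` are joined in the contracted graph by `e₂`
  have hpq : p ∈ cluster (contractSeries ends u p q e₁ e₂) ω x →
      q ∈ cluster (contractSeries ends u p q e₁ e₂) ω x := fun hp =>
    mem_cluster_of_edge hp h₂ (contractSeries_apply_e₂ hs.ne)
  have hqp : q ∈ cluster (contractSeries ends u p q e₁ e₂) ω x →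
      p ∈ cluster (contractSeries ends u p q e₁ e₂) ω x := fun hq =>
    mem_cluster_of_edge hq h₂ (ends_swap (contractSeries_apply_e₂ hs.ne))
  by_cases he₁ : e = e₁
  · subst he₁
    rw [hs.ends₁, Sym2.eq_iff] at hends
    rcases hends with ⟨rfl, rfl⟩ | ⟨rfl, rfl⟩
    · -- `a = u`, `b = p`
      rcases ha with h | ⟨_, hp⟩
      · exact absurd h (u_notMem_cluster_contract hs hx)
      · exact Or.inl hp
    · -- `a = p`, `b = u`
      exact Or.inr ⟨rfl, hS _ hs.up.symm ha⟩
  by_cases he₂ : e = e₂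
  · subst he₂
    rw [hs.ends₂, Sym2.eq_iff] at hends
    rcases hends with ⟨rfl, rfl⟩ | ⟨rfl, rfl⟩
    · rcases ha with h | ⟨_, hp⟩
      · exact absurd h (u_notMem_cluster_contract hs hx)
      · exact Or.inl (hpq hp)
    · exact Or.inr ⟨rfl, hqp (hS _ hs.uq.symm ha)⟩
  · have hau : a ≠ u := ne_u_of_mem_ends hs he₁ he₂ (by rw [hends]; exact Sym2.mem_mk_left a b)
    have ha' := hS a hau ha
    refine Or.inl (mem_cluster_of_edge ha' he ?_)
    rw [contractSeries_apply_of_ne he₁ he₂]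
    exact hends

omit [Fintype E] in
/-- **Contraction keeps the clusters on `V ∖ {u}`.** -/
theorem mem_cluster_contract_iff {x v : V} (hx : x ≠ u) (hv : v ≠ u) :
    v ∈ cluster ends ω x ↔ v ∈ cluster (contractSeries ends u p q e₁ e₂) ω x := by
  constructor
  · intro h
    rcases cluster_subset_contract hs h₁ h₂ hx h with h' | ⟨rfl, _⟩
    · exact h'
    · exact absurd rfl hv
  · exact fun h => cluster_contract_subset hs h₁ h₂ x h

omit [Fintype E] in
/-- **`u` rides with `p` under contraction.** -/
theorem mem_cluster_contract_u_iff {x : V} (hx : x ≠ u) :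
    u ∈ cluster ends ω x ↔ p ∈ cluster (contractSeries ends u p q e₁ e₂) ω x := by
  constructor
  · intro h
    rcases cluster_subset_contract hs h₁ h₂ hx h with h' | ⟨_, hp⟩
    · exact absurd h' (u_notMem_cluster_contract hs hx)
    · exact hp
  · intro hp
    have hp' : p ∈ cluster ends ω x := cluster_contract_subset hs h₁ h₂ x hp
    exact mem_cluster_of_edge hp' h₁ (ends_swap hs.ends₁)

end Contract

section ContractClass

variable (hs : IsSeriesAt ends u p q e₁ e₂)
include hs

omit [Fintype E] in
/-- For a configuration with `ζ e₁ = ζ e₂`, membership of a vertex `v ≠ u` in a cluster of `x ≠ u` is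
the same in `G` (for `ζ`) and in `G/u` (for any recolouring of the loop `e₁`). -/
theorem mem_cluster_contract_iff_of_same {ζ : Config E} (hsame : ζ e₁ = ζ e₂) (b : Bool) {x v : V}
    (hx : x ≠ u) (hv : v ≠ u) :
    v ∈ cluster ends ζ x ↔
      v ∈ cluster (contractSeries ends u p q e₁ e₂) (Function.update ζ e₁ b) x := by
  rw [cluster_update_of_loop (contractSeries_apply_e₁ (ends := ends) (p := p) (q := q) (e₂ := e₂))]
  cases h₁ : ζ e₁ with
  | true => exact mem_cluster_contract_iff hs h₁ (hsame ▸ h₁) hx hv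
  | false =>
    rw [cluster_eq_of_closed (fun e he₁ he₂ => contractSeries_apply_of_ne he₁ he₂) h₁ (hsame ▸ h₁)]

omit [Fintype E] in
/-- `u` rides with `p` (both edges open) or is alone (both closed). -/
theorem mem_cluster_contract_u_iff_of_same {ζ : Config E} (hsame : ζ e₁ = ζ e₂) (b : Bool) {x : V}
    (hx : x ≠ u) :
    u ∈ cluster ends ζ x ↔
      (ζ e₁ = true ∧ p ∈ cluster (contractSeries ends u p q e₁ e₂) (Function.update ζ e₁ b) x) := by
  rw [cluster_update_of_loop (contractSeries_apply_e₁ (ends := ends) (p := p) (q := q) (e₂ := e₂))]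
  cases h₁ : ζ e₁ with
  | true =>
    simp only [true_and]
    exact mem_cluster_contract_u_iff hs h₁ (hsame ▸ h₁) hx
  | false =>
    simp only [Bool.false_eq_true, false_and, iff_false]
    intro hu
    -- with both edges closed `u` is isolated in `G` as well
    rw [← cluster_eq_of_closed (fun e he₁ he₂ => contractSeries_apply_of_ne he₁ he₂) h₁
      (hsame ▸ h₁)] at hu
    exact u_notMem_cluster_contract hs hx hu

omit [Fintype E] in
/-- The edges touching `U ∖ {u}` in `G/u` are the edges touching `U` in `G` other than `e₁`. -/
lemma mem_touches_contract_iff {U : Set V} (hu : u ∈ U) (hp : p ∈ U) {e : E} :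
    e ∈ touches (contractSeries ends u p q e₁ e₂) (U \ {u}) ↔ e ∈ touches ends U ∧ e ≠ e₁ := by
  by_cases he₁ : e = e₁
  · subst he₁
    simp only [ne_eq, not_true_eq_false, and_false, iff_false]
    rintro ⟨x, hx, y, hxy⟩
    rw [contractSeries_apply_e₁, Sym2.eq_iff] at hxy
    rcases hxy with ⟨rfl, _⟩ | ⟨_, rfl⟩
    · exact hx.2 rfl
    · exact hx.2 rfl
  by_cases he₂ : e = e₂
  · subst he₂
    simp only [ne_eq, he₁, not_false_eq_true, and_true]
    constructor
    · intro _
      exact ⟨u, hu, q, hs.ends₂⟩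
    · intro _
      exact ⟨p, ⟨hp, hs.up.symm⟩, q, contractSeries_apply_e₂ hs.ne⟩
  · simp only [ne_eq, he₁, not_false_eq_true, and_true]
    constructor
    · rintro ⟨x, hx, y, hxy⟩
      rw [contractSeries_apply_of_ne he₁ he₂] at hxy
      exact ⟨x, hx.1, y, hxy⟩
    · rintro ⟨x, hx, y, hxy⟩
      have hxu : x ≠ u := ne_u_of_mem_ends hs he₁ he₂ (by rw [hxy]; exact Sym2.mem_mk_left x y)
      exact ⟨x, ⟨hx, hxu⟩, y, by rw [contractSeries_apply_of_ne he₁ he₂]; exact hxy⟩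

end ContractClass

section ContractClass2

variable (hs : IsSeriesAt ends u p q e₁ e₂)
include hs

/-- **The class correspondence of the contraction**: a configuration with `ζ e₁ = ζ e₂` lies in the
outside class of `(G, U, ξ)` iff its canonical image (the loop `e₁` recoloured `false`) lies in the
outside class of `(G/u, U ∖ {u}, ξ[e₁ ↦ false])`. -/
theorem mem_swOutSide_contract_iff_of_same {U : Set V} {ξ : Config E} {l h o : V} (hu : u ∈ U)
    (hp : p ∈ U) (huh : u ≠ h) (hul : u ≠ l) (huo : u ≠ o) {ζ : Config E}
    (hsame : ζ e₁ = ζ e₂) :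
    ζ ∈ swOutSide ends l h o U ξ ↔
      Function.update ζ e₁ false ∈
        swOutSide (contractSeries ends u p q e₁ e₂) l h o (U \ {u}) (Function.update ξ e₁ false) := by
  have hsame' : blue ζ e₁ = blue ζ e₂ := by simp [blue, hsame]
  have hblue : blue (Function.update ζ e₁ false) = Function.update (blue ζ) e₁ true := by
    rw [blue_update]; rfl
  -- the four cluster memberships of `tgtU`
  have hA : ∀ v, v ≠ u → (v ∈ cluster ends ζ l ↔
      v ∈ cluster (contractSeries ends u p q e₁ e₂) (Function.update ζ e₁ false) l) :=
    fun v hv => mem_cluster_contract_iff_of_same hs hsame false hul.symm hv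
  have hB : ∀ v, v ≠ u → (v ∈ cluster ends (blue ζ) l ↔
      v ∈ cluster (contractSeries ends u p q e₁ e₂) (blue (Function.update ζ e₁ false)) l) := by
    intro v hv
    rw [hblue]
    exact mem_cluster_contract_iff_of_same hs hsame' true hul.symm hv
  have hT : ∀ v, v ≠ u → (v ∈ cluster ends ζ h ↔
      v ∈ cluster (contractSeries ends u p q e₁ e₂) (Function.update ζ e₁ false) h) :=
    fun v hv => mem_cluster_contract_iff_of_same hs hsame false huh.symm hv
  have hT' : ∀ v, v ≠ u → (v ∈ cluster ends (blue ζ) h ↔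
      v ∈ cluster (contractSeries ends u p q e₁ e₂) (blue (Function.update ζ e₁ false)) h) := by
    intro v hv
    rw [hblue]
    exact mem_cluster_contract_iff_of_same hs hsame' true huh.symm hv
  have he₁U : e₁ ∈ touches ends U := ⟨u, hu, p, hs.ends₁⟩
  have he₂U : e₂ ∈ touches ends U := ⟨u, hu, q, hs.ends₂⟩
  rw [mem_swOutSide, mem_swOutSide, mem_outClass, mem_outClass]
  simp only [tgtU, Finset.mem_filter, Finset.mem_univ, true_and, Set.mem_setOf_eq, hull,
    Set.mem_union, not_or]
  constructor
  · rintro ⟨⟨⟨hhA, hhB⟩, hoA, hoB⟩, hpin, hhull⟩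
    refine ⟨⟨⟨?_, ?_⟩, ?_, ?_⟩, ?_, ?_⟩
    · exact fun h' => hhA ((hA h huh.symm).2 h')
    · exact fun h' => hhB ((hB h huh.symm).2 h')
    · exact (hA o huo.symm).1 hoA
    · exact fun h' => hoB ((hB o huo.symm).2 h')
    · intro e he
      rw [mem_touches_contract_iff hs hu hp] at he
      by_cases he₁ : e = e₁
      · subst he₁; simp
      · have heU : e ∉ touches ends U := fun h' => he ⟨h', he₁⟩
        have he₂ : e ≠ e₂ := by rintro rfl; exact heU he₂U
        rw [Function.update_of_ne he₁, Function.update_of_ne he₁]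
        exact hpin e heU
    · intro v hv
      have hvu : v ≠ u := by
        rintro rfl
        rcases hv with hv | hv
        · exact u_notMem_cluster_contract hs huh.symm hv
        · exact u_notMem_cluster_contract hs huh.symm hv
      refine ⟨hhull ?_, hvu⟩
      rcases hv with hv | hv
      · exact Or.inl ((hT v hvu).2 hv)
      · exact Or.inr ((hT' v hvu).2 hv)
  · rintro ⟨⟨⟨hhA, hhB⟩, hoA, hoB⟩, hpin, hhull⟩
    refine ⟨⟨⟨?_, ?_⟩, ?_, ?_⟩, ?_, ?_⟩
    · exact fun h' => hhA ((hA h huh.symm).1 h')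
    · exact fun h' => hhB ((hB h huh.symm).1 h')
    · exact (hA o huo.symm).2 hoA
    · exact fun h' => hoB ((hB o huo.symm).1 h')
    · intro e he
      have he₁ : e ≠ e₁ := by rintro rfl; exact he he₁U
      have he' : e ∉ touches (contractSeries ends u p q e₁ e₂) (U \ {u}) := by
        rw [mem_touches_contract_iff hs hu hp]; exact fun h' => he h'.1
      have := hpin e he'
      rwa [Function.update_of_ne he₁, Function.update_of_ne he₁] at this
    · intro v hv
      by_cases hvu : v = u
      · exact hvu ▸ hu
      · refine (hhull ?_).1
        rcases hv with hv | hv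
        · exact Or.inl ((hT v hvu).1 hv)
        · exact Or.inr ((hT' v hvu).1 hv)

end ContractClass2

end LocRows

end Summit.Ventures.PercRepro2
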